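/-
Copyright (c) 2026 the pub-hodgecm-mathlib formalisation cell (harness21).  Prover seat hodgecm-mathlib-LH4-p16 (g0), req620 Track A «(D-RAM) FOUR-FRAME» squad
(STAGE-1b, row (2) of the piece `f_{T₊}`, the (β₂) road under heir LEAD F0P3a-plan (g21) T20-19 (R-36) «RELATIVE SIGNS»; row (L-K) holder; β₂-board sub-dealer
LH4-p04 (g8) BETA2-BOARD v1.1 — rows = signed-count identities BETWEEN two cells along explicit `k : 1` maps), 2026-09-04.
-/
import Summits.HodgeConjecture.HodgeConjecture.Theorems.F0P3cDyRamConeCellFaceTube      -- ★ p861208 (this seat): `finsum_mem_const_eq_mul_ncard`; brings Mathlib `Set.ncard`, `finsum`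
import HarnessLib

/-!
# Crux `H413`, line LH4 «(D-RAM) FOUR-FRAME» — STAGE-1b, row (2), the (β₂) road (R-36): «`k : 1` TRANSPORT OF THE LABELLED CELL DIFFERENCE» — a map `π : S′ → S` between two finite
# cells with constant fibre size `k`, pulling back weights and labels (resp. exchanging the labels), gives `cellDiff(S′) = k·cellDiff(S)` (resp. `= −k·cellDiff(S)`)

Cell `hodgecm-mathlib` (D-0151), FLOOR 0, crux item H413 = `stmt-HodgeConjecture-24833`, route of record `HCCMUnconditional`; squad F0∕P3c∕LH4; lane
`--supports stmt-HodgeConjecture-24833 --as helper` (count-neutral; pays NO tier-0 row).  THEOREMS ONLY (no `def`, no instance, no notation, no `sorry`, default heartbeats).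
ABSTRACT (two types `X, X′`, finite cells `S ⊆ X`, `S′ ⊆ X′`, any map `π : X′ → X`, ℕ-weights, `Prop`-labels).

WHY (heir LEAD T20-19 (R-36) ADDENDUM; LH4-cdis1 (g0) 15:28:14Z ∕ 15:32:52Z relative tables; β₂-BOARD v1.1).  The pure-cell ledger is proved by RELATIVE identities between cells:
U-type `cellDiff₁(S₁) = ∓2·cellDiff₁(D)` and the lit-2 tower `T₁ = 4D₂, T_{i+1} = 2T_i, T_k = −2T_{k−1}` ((L-S1)∕(L-T), LH4-p09: conductor-drop ∕ tube-shift maps of fibre 2);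
RamM `cellDiff_t(K₀) = ∓cellDiff_t(D)` (δ = 6 ∕ δ ≥ 8) and `cellDiff₂(K₀) = cellDiff₁(K₀)` (δ = 4) ((L-K), this seat); cross-literal `cellDiff₂(D) = −cellDiff₁(D)` ((L-D×), LH4-p19).
Each is the image of ONE explicit map `π` from the cell `S′` onto the cell `S` with constant fibre size `k ∈ {1, 2}` along which the glue weight is pulled back (`f′ = f ∘ π` on `S′`)
and the label is pulled back or exchanged (the row's `hface`, read off ★ p861372 ∕ the depth scalar).  THIS FILE is the bookkeeping socket all of them plug into:
* §1 `finsum_mem_inter_eq_mul_finsum_of_fibres` — `Σᶠ_{x′ ∈ S′ ∩ {P′}} f′ x′ = k·Σᶠ_{x ∈ S ∩ {P}} f x` when `π(S′) ⊆ S`, every `x ∈ S` has exactly `k` preimages in `S′`, `f′ = f ∘ π` and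
  `P′ ↔ P ∘ π` on `S′` (Mathlib `Finset.sum_fiberwise_of_maps_to`; `S, S′` finite).
* §2 HEADS `cellDiff_eq_mul_cellDiff_of_fibres` (labels pulled back: `(Σᶠ_{S′∩P′} f′ : ℤ) − Σᶠ_{S′∩Q′} f′ = k·((Σᶠ_{S∩P} f : ℤ) − Σᶠ_{S∩Q} f)`) and
  `cellDiff_eq_neg_mul_cellDiff_of_fibres_exchange` (labels exchanged: `P′ ↔ Q ∘ π`, `Q′ ↔ P ∘ π` ⇒ `… = −k·(…)`); the unweighted AXIS twins `ncard_inter_eq_mul_ncard_of_fibres` ∕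
  `ncardDiff_eq_[neg_]mul_ncardDiff_of_fibres[_exchange]`.
HONEST LABEL.  Count-neutral bookkeeping; nothing printed is asserted; which maps `π` exist with which fibres and label behaviour is the ROWS' business; `HC_CM` is proved only modulo
the 7 printed citations (2 remaining named inputs: hLiu418 = `stmt-HodgeConjecture-24832`, h413 = `stmt-HodgeConjecture-24833`) until rung 0 closes.
## References
* [Kottwitz1986BaseChangeUnits] R. E. Kottwitz, *Base change for unit elements of Hecke algebras*, Compositio Math. 60 (1986): §1 pp. 240–241 (fixed-lattice counts as orbital integrals).
* [LabesseLanglands1979] J.-P. Labesse, R. P. Langlands, *L-indistinguishability for SL(2)*, Canad. J. Math. 31 (1979): §2 p. 8 (signed counts by norm class).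
* [Rogawski1990] J. D. Rogawski, *Automorphic Representations of Unitary Groups in Three Variables*, Ann. of Math. Stud. 123 (1990): §4.9 Prop. 4.9.1 (b) p. 55.
-/

set_option autoImplicit false

namespace Summit.HodgeConjecture.HodgeConjecture.Cruxes.H413.F0P3cDyRamCellDiffTransport

open scoped Classical

variable {X X' : Type*}

/-! ## §1 Weighted labelled sums along a `k : 1` map -/

/-- **`Σᶠ_{S′ ∩ {P′}} f′ = k · Σᶠ_{S ∩ {P}} f` ALONG A `k : 1` MAP.**  For finite cells `S ⊆ X`, `S′ ⊆ X′` and `π : X′ → X` with `π(S′) ⊆ S`, constant fibres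
(`#{x′ ∈ S′ ∣ π x′ = x} = k` for `x ∈ S`), pulled-back weight (`f′ x′ = f (π x′)` on `S′`) and pulled-back label (`P′ x′ ↔ P (π x′)` on `S′`).
[cite: Kottwitz1986BaseChangeUnits, §1 pp. 240–241] -/
theorem finsum_mem_inter_eq_mul_finsum_of_fibres {N : Type*} [AddCommMonoid N] (S : Set X) (S' : Set X') (hS : S.Finite) (hS' : S'.Finite) (π : X' → X)
    (hπ : ∀ x' ∈ S', π x' ∈ S) (k : ℕ) (hk : ∀ x ∈ S, {x' ∈ S' | π x' = x}.ncard = k)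
    (f : X → N) (f' : X' → N) (hf : ∀ x' ∈ S', f' x' = f (π x')) (P : X → Prop) (P' : X' → Prop) (hP : ∀ x' ∈ S', P' x' ↔ P (π x')) :
    ∑ᶠ x' ∈ S' ∩ {x' | P' x'}, f' x' = k • ∑ᶠ x ∈ S ∩ {x | P x}, f x := by
  have hT : (S ∩ {x | P x}).Finite := hS.subset Set.inter_subset_left
  have hT' : (S' ∩ {x' | P' x'}).Finite := hS'.subset Set.inter_subset_left
  rw [finsum_mem_eq_finite_toFinset_sum _ hT, finsum_mem_eq_finite_toFinset_sum _ hT', Finset.smul_sum]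
  have hmaps : ∀ x' ∈ hT'.toFinset, π x' ∈ hT.toFinset := fun x' hx' => by
    rw [Set.Finite.mem_toFinset] at hx' ⊢
    exact ⟨hπ x' hx'.1, (hP x' hx'.1).1 hx'.2⟩
  rw [← Finset.sum_fiberwise_of_maps_to hmaps]
  refine Finset.sum_congr rfl fun x hx => ?_
  rw [Set.Finite.mem_toFinset] at hx
  -- on the fibre over `x ∈ S ∩ {P}` the summand is the constant `f x`, and the fibre inside `S′ ∩ {P′}` is the whole fibre inside `S′`
  have hfib : (hT'.toFinset.filter fun x' => π x' = x) = (hS'.subset (Set.sep_subset S' fun x' => π x' = x)).toFinset := by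
    ext x'
    simp only [Finset.mem_filter, Set.Finite.mem_toFinset, Set.mem_inter_iff, Set.mem_setOf_eq]
    constructor
    · rintro ⟨⟨hx'S, -⟩, hπx⟩; exact ⟨hx'S, hπx⟩
    · rintro ⟨hx'S, hπx⟩; exact ⟨⟨hx'S, (hP x' hx'S).2 (hπx ▸ hx.2)⟩, hπx⟩
  rw [hfib]
  have hconst : ∀ x' ∈ (hS'.subset (Set.sep_subset S' fun x' => π x' = x)).toFinset, f' x' = f x := fun x' hx' => by
    rw [Set.Finite.mem_toFinset] at hx'
    rw [hf x' hx'.1, hx'.2]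
  rw [Finset.sum_congr rfl hconst, Finset.sum_const, ← Set.ncard_eq_toFinset_card _ (hS'.subset (Set.sep_subset S' fun x' => π x' = x)), hk x hx.1]

/-- **AXIS TWIN: `#(S′ ∩ {P′}) = k · #(S ∩ {P})`** along a `k : 1` map with pulled-back label. [cite: Kottwitz1986BaseChangeUnits, §1 pp. 240–241] -/
theorem ncard_inter_eq_mul_ncard_of_fibres (S : Set X) (S' : Set X') (hS : S.Finite) (hS' : S'.Finite) (π : X' → X)
    (hπ : ∀ x' ∈ S', π x' ∈ S) (k : ℕ) (hk : ∀ x ∈ S, {x' ∈ S' | π x' = x}.ncard = k)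
    (P : X → Prop) (P' : X' → Prop) (hP : ∀ x' ∈ S', P' x' ↔ P (π x')) :
    (S' ∩ {x' | P' x'}).ncard = k * (S ∩ {x | P x}).ncard := by
  have h := finsum_mem_inter_eq_mul_finsum_of_fibres S S' hS hS' π hπ k hk (fun _ => (1 : ℕ)) (fun _ => (1 : ℕ)) (fun _ _ => rfl) P P' hP
  rw [smul_eq_mul, Summit.HodgeConjecture.HodgeConjecture.Cruxes.H413.F0P3cDyRamConeCellFaceTube.finsum_mem_const_eq_mul_ncard (S' ∩ {x' | P' x'}) 1,
    Summit.HodgeConjecture.HodgeConjecture.Cruxes.H413.F0P3cDyRamConeCellFaceTube.finsum_mem_const_eq_mul_ncard (S ∩ {x | P x}) 1, one_mul, one_mul] at h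
  exact h

/-! ## §2 HEADS — the labelled cell difference along a `k : 1` map: pulled back, or exchanged -/

/-- **HEAD — `cellDiff(S′) = k·cellDiff(S)` ALONG A LABEL-PRESERVING `k : 1` MAP** (`P′ ↔ P ∘ π`, `Q′ ↔ Q ∘ π`, `f′ = f ∘ π` on `S′`).
[cite: Kottwitz1986BaseChangeUnits, §1 pp. 240–241] [cite: Rogawski1990, §4.9 Prop. 4.9.1 (b) p. 55] -/
theorem cellDiff_eq_mul_cellDiff_of_fibres (S : Set X) (S' : Set X') (hS : S.Finite) (hS' : S'.Finite) (π : X' → X)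
    (hπ : ∀ x' ∈ S', π x' ∈ S) (k : ℕ) (hk : ∀ x ∈ S, {x' ∈ S' | π x' = x}.ncard = k)
    (f : X → ℕ) (f' : X' → ℕ) (hf : ∀ x' ∈ S', f' x' = f (π x')) (P Q : X → Prop) (P' Q' : X' → Prop)
    (hP : ∀ x' ∈ S', P' x' ↔ P (π x')) (hQ : ∀ x' ∈ S', Q' x' ↔ Q (π x')) :
    ((∑ᶠ x' ∈ S' ∩ {x' | P' x'}, f' x' : ℕ) : ℤ) - (∑ᶠ x' ∈ S' ∩ {x' | Q' x'}, f' x' : ℕ) =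
      (k : ℤ) * (((∑ᶠ x ∈ S ∩ {x | P x}, f x : ℕ) : ℤ) - (∑ᶠ x ∈ S ∩ {x | Q x}, f x : ℕ)) := by
  rw [finsum_mem_inter_eq_mul_finsum_of_fibres S S' hS hS' π hπ k hk f f' hf P P' hP,
    finsum_mem_inter_eq_mul_finsum_of_fibres S S' hS hS' π hπ k hk f f' hf Q Q' hQ, smul_eq_mul, smul_eq_mul]
  push_cast
  ring

/-- **HEAD — `cellDiff(S′) = −k·cellDiff(S)` ALONG A LABEL-EXCHANGING `k : 1` MAP** (`P′ ↔ Q ∘ π`, `Q′ ↔ P ∘ π`, `f′ = f ∘ π` on `S′`).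
[cite: Kottwitz1986BaseChangeUnits, §1 pp. 240–241] [cite: LabesseLanglands1979, §2 p. 8] -/
theorem cellDiff_eq_neg_mul_cellDiff_of_fibres_exchange (S : Set X) (S' : Set X') (hS : S.Finite) (hS' : S'.Finite) (π : X' → X)
    (hπ : ∀ x' ∈ S', π x' ∈ S) (k : ℕ) (hk : ∀ x ∈ S, {x' ∈ S' | π x' = x}.ncard = k)
    (f : X → ℕ) (f' : X' → ℕ) (hf : ∀ x' ∈ S', f' x' = f (π x')) (P Q : X → Prop) (P' Q' : X' → Prop)
    (hP : ∀ x' ∈ S', P' x' ↔ Q (π x')) (hQ : ∀ x' ∈ S', Q' x' ↔ P (π x')) :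
    ((∑ᶠ x' ∈ S' ∩ {x' | P' x'}, f' x' : ℕ) : ℤ) - (∑ᶠ x' ∈ S' ∩ {x' | Q' x'}, f' x' : ℕ) =
      -((k : ℤ) * (((∑ᶠ x ∈ S ∩ {x | P x}, f x : ℕ) : ℤ) - (∑ᶠ x ∈ S ∩ {x | Q x}, f x : ℕ))) := by
  rw [finsum_mem_inter_eq_mul_finsum_of_fibres S S' hS hS' π hπ k hk f f' hf Q P' hP,
    finsum_mem_inter_eq_mul_finsum_of_fibres S S' hS hS' π hπ k hk f f' hf P Q' hQ, smul_eq_mul, smul_eq_mul]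
  push_cast
  ring

/-- **AXIS TWIN — `#(S′∩P′) − #(S′∩Q′) = k·(#(S∩P) − #(S∩Q))`** along a label-preserving `k : 1` map. [cite: Kottwitz1986BaseChangeUnits, §1 pp. 240–241] -/
theorem ncardDiff_eq_mul_ncardDiff_of_fibres (S : Set X) (S' : Set X') (hS : S.Finite) (hS' : S'.Finite) (π : X' → X)
    (hπ : ∀ x' ∈ S', π x' ∈ S) (k : ℕ) (hk : ∀ x ∈ S, {x' ∈ S' | π x' = x}.ncard = k)
    (P Q : X → Prop) (P' Q' : X' → Prop) (hP : ∀ x' ∈ S', P' x' ↔ P (π x')) (hQ : ∀ x' ∈ S', Q' x' ↔ Q (π x')) :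
    ((S' ∩ {x' | P' x'}).ncard : ℤ) - (S' ∩ {x' | Q' x'}).ncard = (k : ℤ) * (((S ∩ {x | P x}).ncard : ℤ) - (S ∩ {x | Q x}).ncard) := by
  rw [ncard_inter_eq_mul_ncard_of_fibres S S' hS hS' π hπ k hk P P' hP, ncard_inter_eq_mul_ncard_of_fibres S S' hS hS' π hπ k hk Q Q' hQ]
  push_cast
  ring

/-- **AXIS TWIN — `#(S′∩P′) − #(S′∩Q′) = −k·(#(S∩P) − #(S∩Q))`** along a label-exchanging `k : 1` map. [cite: LabesseLanglands1979, §2 p. 8] -/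
theorem ncardDiff_eq_neg_mul_ncardDiff_of_fibres_exchange (S : Set X) (S' : Set X') (hS : S.Finite) (hS' : S'.Finite) (π : X' → X)
    (hπ : ∀ x' ∈ S', π x' ∈ S) (k : ℕ) (hk : ∀ x ∈ S, {x' ∈ S' | π x' = x}.ncard = k)
    (P Q : X → Prop) (P' Q' : X' → Prop) (hP : ∀ x' ∈ S', P' x' ↔ Q (π x')) (hQ : ∀ x' ∈ S', Q' x' ↔ P (π x')) :
    ((S' ∩ {x' | P' x'}).ncard : ℤ) - (S' ∩ {x' | Q' x'}).ncard = -((k : ℤ) * (((S ∩ {x | P x}).ncard : ℤ) - (S ∩ {x | Q x}).ncard)) := by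
  rw [ncard_inter_eq_mul_ncard_of_fibres S S' hS hS' π hπ k hk Q P' hP, ncard_inter_eq_mul_ncard_of_fibres S S' hS hS' π hπ k hk P Q' hQ]
  push_cast
  ring

end Summit.HodgeConjecture.HodgeConjecture.Cruxes.H413.F0P3cDyRamCellDiffTransport
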